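import Literature.Geometry.Symplectic.TaubesFamilyBetaWeitzenbock
import HarnessLib

/-!
# `|D_Aβ|² = |∂̄'α|²` along the family `(SW_r)`: Hutchings–Taubes (4.10)–(4.11) in energy form

Topic `Literature/Geometry/Symplectic`.  In the fibre model, `γ_ku₀` for the four Clifford generators
is `(0; 0,-1)`, `(0; 0,-i)`, `(0; 1,0)`, `(0; i,0)` (`cliffordBasis_*_mulVec_plusUnit`), so Clifford
multiplication of `u₀` by a complex covector `θ` is `γ_ℂ(θ)u₀ = (0; θ₂+iθ₃, -(θ₀+iθ₁)) ∈ S⁻` with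
`|γ_ℂ(θ)u₀|² = |θ₀+iθ₁|² + |θ₂+iθ₃|²` (`spinorHermNormSq_cliffordComplexOneForm_mulVec_plusUnit`) — the
`∂̄`-part of `θ` in the unitary frame.  With the split Dirac equation `D_Aβ = -(∇'α)·u₀`
(`TaubesFamilyBetaField`) this identifies `|D_Aβ|²` with the `∂̄`-energy density
`|∇'₀α+i∇'₁α|² + |∇'₂α+i∇'₃α|²` of `TaubesFamilyAlphaEnergy` (`hermNormSq_diracField_betaField_eq`,
Hutchings–Taubes (4.10) `|∂̄_a^*β| = |∂̄_aα|`), and the Weitzenböck inequality on `β`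
(`TaubesFamilyBetaWeitzenbock`) becomes Hutchings–Taubes (4.11) in the form used in (4.16)–(4.19):

  `∫ ((r/4 - K/4 - P/2)|β|² + ¼|β|⁴ - ¼|α|²|β|² - (|∇'₀α+i∇'₁α|² + |∇'₂α+i∇'₃α|²))(s ∧ s) ≤ 0`

(`integral_betaSq_le_dbar_energy`).

PROVED, 0 named facts.

## References

* M. Hutchings, C. H. Taubes, *An introduction to the Seiberg–Witten equations on symplectic
  manifolds*, IAS/Park City Math. Ser. 7 (1999; AMS 2006), §4.3 (4.9), §4.4 (4.10)–(4.11). [HutchingsTaubes2006]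
* C. H. Taubes, *The Seiberg–Witten invariants and symplectic forms*, Math. Res. Lett. 1 (1994)
  809–822, §3 (15), (19)–(20). [Taubes1994]
-/

noncomputable section

open scoped Manifold ContDiff Topology ComplexConjugate Matrix Quaternion
open Set Function Filter Complex Literature.Geometry.Kaehler Literature.Geometry.GaugeTheory Literature.Topology.FourManifolds
open Literature.Geometry.Lorentzian (PseudoRiemannianMetric)
open Literature.Geometry.Manifold Literature.Geometry.Manifold.DeRhamSignFour Literature.NumberTheory.Transcendental

namespace Literature.Geometry.GaugeTheory

/-! ### `γ_k u₀` and `|γ_ℂ(θ)u₀|²` in the fibre model -/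

/-- `γ₀u₀ = (0; 0, -1)`. [cite: MorganSWBook1996, §2.4 Example (ii)] -/
theorem cliffordBasis_zero_mulVec_plusUnit : cliffordBasis 0 *ᵥ plusUnit = Sum.elim (0 : Fin 2 → ℂ) ![0, -1] := by
  ext (a | a) <;> fin_cases a <;>
    simp [cliffordBasis, cliffordGamma, quatBasis, plusUnit, Literature.MathematicalPhysics.QuantumLattice.quatMatrix,
      Matrix.mulVec, dotProduct, Matrix.fromBlocks, Pi.single_apply]

/-- `γ₁u₀ = (0; 0, -i)`. [cite: MorganSWBook1996, §2.4 Example (ii)] -/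
theorem cliffordBasis_one_mulVec_plusUnit : cliffordBasis 1 *ᵥ plusUnit = Sum.elim (0 : Fin 2 → ℂ) ![0, -I] := by
  ext (a | a) <;> fin_cases a <;>
    simp [cliffordBasis, cliffordGamma, quatBasis, plusUnit, Literature.MathematicalPhysics.QuantumLattice.quatMatrix,
      Matrix.mulVec, dotProduct, Matrix.fromBlocks, Pi.single_apply]

/-- `γ₂u₀ = (0; 1, 0)`. [cite: MorganSWBook1996, §2.4 Example (ii)] -/
theorem cliffordBasis_two_mulVec_plusUnit : cliffordBasis 2 *ᵥ plusUnit = Sum.elim (0 : Fin 2 → ℂ) ![1, 0] := by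
  ext (a | a) <;> fin_cases a <;>
    simp [cliffordBasis, cliffordGamma, quatBasis, plusUnit, Literature.MathematicalPhysics.QuantumLattice.quatMatrix,
      Matrix.mulVec, dotProduct, Matrix.fromBlocks, Pi.single_apply]

/-- `γ₃u₀ = (0; i, 0)`. [cite: MorganSWBook1996, §2.4 Example (ii)] -/
theorem cliffordBasis_three_mulVec_plusUnit : cliffordBasis 3 *ᵥ plusUnit = Sum.elim (0 : Fin 2 → ℂ) ![I, 0] := by
  ext (a | a) <;> fin_cases a <;>
    simp [cliffordBasis, cliffordGamma, quatBasis, plusUnit, Literature.MathematicalPhysics.QuantumLattice.quatMatrix,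
      Matrix.mulVec, dotProduct, Matrix.fromBlocks, Pi.single_apply]

variable {X : Type*} [TopologicalSpace X] [ChartedSpace (EuclideanSpace ℝ (Fin 4)) X]

namespace SpincStructure

/-- **`γ_ℂ(θ)u₀ = (0; θ₂+iθ₃, -(θ₀+iθ₁))`**: Clifford multiplication of `u₀` by a complex covector lands in
`S⁻` and reads off the `(0,1)`-part of `θ` (`θ_k = θ(e_k)`). [cite: HutchingsTaubes2006, §4.3 (4.9)] -/
theorem cliffordComplexOneForm_mulVec_plusUnit (θ : (x : X) → TangentSpace (𝓡 4) x → ℂ) (x : X)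
    (e : Fin 4 → TangentSpace (𝓡 4) x) :
    cliffordComplexOneForm θ x e *ᵥ plusUnit =
      Sum.elim (0 : Fin 2 → ℂ) ![θ x (e 2) + I * θ x (e 3), -(θ x (e 0) + I * θ x (e 1))] := by
  simp only [cliffordComplexOneForm, Fin.sum_univ_four, Matrix.add_mulVec, Matrix.smul_mulVec,
    cliffordBasis_zero_mulVec_plusUnit, cliffordBasis_one_mulVec_plusUnit, cliffordBasis_two_mulVec_plusUnit,
    cliffordBasis_three_mulVec_plusUnit]
  funext a
  rcases a with a | a <;> fin_cases a <;> simp <;> ring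

/-- **`|γ_ℂ(θ)u₀|² = |θ₀+iθ₁|² + |θ₂+iθ₃|²`.** [cite: HutchingsTaubes2006, §4.3 (4.9)] -/
theorem spinorHermNormSq_cliffordComplexOneForm_mulVec_plusUnit (θ : (x : X) → TangentSpace (𝓡 4) x → ℂ) (x : X)
    (e : Fin 4 → TangentSpace (𝓡 4) x) :
    spinorHermNormSq (cliffordComplexOneForm θ x e *ᵥ plusUnit) =
      Complex.normSq (θ x (e 0) + I * θ x (e 1)) + Complex.normSq (θ x (e 2) + I * θ x (e 3)) := by
  rw [cliffordComplexOneForm_mulVec_plusUnit, spinorHermNormSq, Fintype.sum_sum_type, Fin.sum_univ_two, Fin.sum_univ_two]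
  simp only [Sum.elim_inl, Sum.elim_inr, Pi.zero_apply, map_zero, zero_add, Matrix.cons_val_zero, Matrix.cons_val_one,
    Complex.normSq_neg]
  ring

end SpincStructure

/-- `|-v|² = |v|²`. [folklore] -/
theorem spinorHermNormSq_neg (v : Spinor → ℂ) : spinorHermNormSq (-v) = spinorHermNormSq v := by
  simp [spinorHermNormSq]

end Literature.Geometry.GaugeTheory

namespace Literature.Geometry.Symplectic

open Literature.Geometry.GaugeTheory.SpincStructure

namespace AlmostComplexStructure.IsCompatibleWith

variable {N : Type} [TopologicalSpace N] [ChartedSpace (EuclideanSpace ℝ (Fin 4)) N] [IsManifold (𝓡 4) ∞ N]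
  {J : AlmostComplexStructure (𝓡 4) ∞ N} {s : MForm (𝓡 4) N ℝ 2}
  (h : J.IsCompatibleWith s) (hs : IsSmoothForm s)
  (hnd : ∀ x (v : TangentSpace (𝓡 4) x), v ≠ 0 → ∃ w : TangentSpace (𝓡 4) x, s x ![v, w] ≠ 0)

/-- **`|D_Aβ|² = |∇'₀α+i∇'₁α|² + |∇'₂α+i∇'₃α|²` for a solution** (`D_Aβ = -(∇'α)·u₀`): Hutchings–Taubes's
`|∂̄_a^*β|² = |∂̄_aα|²`, in the unitary frame of the chart at the point. [cite: HutchingsTaubes2006, §4.4 (4.10)] -/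
theorem hermNormSq_diracField_betaField_eq [(h.metric hs).HasLeviCivita] (hcl : IsClosedForm s)
    {η : (h.canonicalSpincStructure hs hnd).Perturbation} {cfg : (h.canonicalSpincStructure hs hnd).Configuration}
    (hsol : SpincStructure.IsSolution η cfg) (x : N) :
    ((h.canonicalSpincStructure hs hnd).diracField cfg.conn (h.isSmooth_betaField hs hnd cfg)).hermNormSq x =
      Complex.normSq (connDeriv (h.alphaFun hs hnd cfg) (h.halfConnectionDiff hs hnd cfg) x
            ((h.canonicalSpincStructure hs hnd).frame ((h.canonicalSpincStructure hs hnd).indexAt x) 0 x) +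
          I * connDeriv (h.alphaFun hs hnd cfg) (h.halfConnectionDiff hs hnd cfg) x
            ((h.canonicalSpincStructure hs hnd).frame ((h.canonicalSpincStructure hs hnd).indexAt x) 1 x)) +
        Complex.normSq (connDeriv (h.alphaFun hs hnd cfg) (h.halfConnectionDiff hs hnd cfg) x
            ((h.canonicalSpincStructure hs hnd).frame ((h.canonicalSpincStructure hs hnd).indexAt x) 2 x) +
          I * connDeriv (h.alphaFun hs hnd cfg) (h.halfConnectionDiff hs hnd cfg) x
            ((h.canonicalSpincStructure hs hnd).frame ((h.canonicalSpincStructure hs hnd).indexAt x) 3 x)) := by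
  rw [SpinorField.hermNormSq, SpincStructure.diracField_toFun,
    h.dirac_betaField_eq_of_isSolution hs hnd hcl hsol _ ((h.canonicalSpincStructure hs hnd).mem_baseSet_indexAt x),
    spinorHermNormSq_neg, SpincStructure.spinorHermNormSq_cliffordComplexOneForm_mulVec_plusUnit]

/-- **Hutchings–Taubes (4.11) for the family, energy form**: for a solution `(A, ψ = αu₀ + β)` of
`(SW)` with perturbation `P₊F_{A₀} - (r/4)s`, `r = |c|²`,
`∫ ((r/4 - K/4 - P/2)|β|² + ¼|β|⁴ - ¼|α|²|β|² - (|∇'₀α+i∇'₁α|² + |∇'₂α+i∇'₃α|²))(s ∧ s) ≤ 0`,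
`K = sup κ⁻`, `P = sup ‖P₊F_{A₀}‖`. [cite: HutchingsTaubes2006, §4.4 (4.11)] [cite: Taubes1994, §3 (20)] -/
theorem integral_betaSq_le_dbar_energy [T2Space N] [CompactSpace N] [(h.metric hs).HasLeviCivita]
    (hcl : IsClosedForm s) (c : ℂ) {cfg : (h.canonicalSpincStructure hs hnd).Configuration}
    (hsol : SpincStructure.IsSolution (h.taubesPerturbation hs hnd - h.symplecticPerturbation hs hnd (Complex.normSq c / 4)) cfg) :
    MForm.integral (rayFamily (wedge_self_castDeg_apply_ne_zero s hnd))
      ((fun x ↦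
        (Complex.normSq c / 4 - (⨆ y, max (-(h.metric hs).scalarCurvature y) 0) / 4
            - (⨆ y, (h.canonicalSpincStructure hs hnd).perturbationNorm (h.taubesPerturbation hs hnd)
                ((h.canonicalSpincStructure hs hnd).indexAt y) y) / 2) * h.betaSq hs hnd cfg x
          + 4⁻¹ * h.betaSq hs hnd cfg x ^ 2 - 4⁻¹ * h.alphaSq hs hnd cfg x * h.betaSq hs hnd cfg x
          - (Complex.normSq (connDeriv (h.alphaFun hs hnd cfg) (h.halfConnectionDiff hs hnd cfg) x
                ((h.canonicalSpincStructure hs hnd).frame ((h.canonicalSpincStructure hs hnd).indexAt x) 0 x) +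
              I * connDeriv (h.alphaFun hs hnd cfg) (h.halfConnectionDiff hs hnd cfg) x
                ((h.canonicalSpincStructure hs hnd).frame ((h.canonicalSpincStructure hs hnd).indexAt x) 1 x)) +
            Complex.normSq (connDeriv (h.alphaFun hs hnd cfg) (h.halfConnectionDiff hs hnd cfg) x
                ((h.canonicalSpincStructure hs hnd).frame ((h.canonicalSpincStructure hs hnd).indexAt x) 2 x) +
              I * connDeriv (h.alphaFun hs hnd cfg) (h.halfConnectionDiff hs hnd cfg) x
                ((h.canonicalSpincStructure hs hnd).frame ((h.canonicalSpincStructure hs hnd).indexAt x) 3 x)))) •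
        (s.wedge s).castDeg two_add_two_eq_four) ≤ 0 := by
  have hW := h.integral_betaField_weitzenbock_le hs hnd hcl c hsol
  simp only [h.hermNormSq_diracField_betaField_eq hs hnd hcl hsol] at hW
  exact hW

end AlmostComplexStructure.IsCompatibleWith

end Literature.Geometry.Symplectic

end
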